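import Summits.BirchSwinnertonDyer.BirchSwinnertonDyer.Theorems.ResidualThetaTransportAtTwoThetaLayerLambdaCongruenceAtTwoStarGalois
import Summits.BirchSwinnertonDyer.BirchSwinnertonDyer.Theorems.ResidualThetaTransportAtTwoThetaLayerLambdaCongruenceAtTwoPeriodLift
import Summits.BirchSwinnertonDyer.BirchSwinnertonDyer.Theorems.ResidualThetaTransportAtTwoThetaLayerLambdaCongruenceAtTwoTwoExclusion
import Literature.NumberTheory.EllipticCurves.ModularFormsGamma0Genus
import Mathlib.Algebra.CharP.Two
import HarnessLib

/-!
# Crux `ThetaLayerLambdaCongruenceAtTwo`, line `birth`: (K2) ⟹ (C3k), and (C3k) at the crux's levels from named facts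

Helper file for `stmt-BirchSwinnertonDyer-20688` (no definition, no new obligation).  The registered stub (C3k)
`stub_plusLineCharTwo` («plus multiplicity one over fields of characteristic `2`»: two nonzero even Γ₀(N')-symbol
functions `Ψ₁, Ψ₂ : ℚ → k`, exact Hecke eigenfunctions for `T_q ↦ a_q(W)` (`q ∤ N'`) and `U_ℓ ↦ 0` (`ℓ ∣ N'`), are
proportional) is reduced to the lead's index statement (K2) on `Λ = periodHomology N'` and then PROVED at every level of
the shape the crux uses (`N_W·∏_{ℓ∈S} ℓ² ∣ N'`, `primes(N') ⊆ S`, `N'` odd, good reduction off `2N'`) from six named facts.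

* §1 `exists_periodHomology_coe_eq_dualMap_heckeT`: the linear form `F` of a symbol function `Ψ` on `Λ`
  (`…PeriodLift.exists_addMonoidHom_periodHomology`, `F{∞,γ∞} = Ψ(γ∞)`) satisfies `F(T_p^∨ λ) = b·F(λ)` on ALL of `Λ` when
  `T_pΨ = bΨ` in the shape of (C3k) (`exists_heckeT_translates`, `sum_translates_eq_smul_of_eigen`, closure induction).
* §2 `plusLineCharTwo_of_kTwo`: (K2) ⟹ (C3k) at a fixed odd level `N`.  With `Fᵢ` the linear forms of `Ψᵢ` (they exist:
  `T₂Ψᵢ = a₂Ψᵢ = 0` as `2 ∣ a₂`; genus formula `twelve_mul_finrank_cuspForm_two_gamma0_holds`), the subgroup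
  `K = ker F₁ ∩ ker F₂ ⊆ Λ` contains `2Λ`, `(T_q^∨ − a_q)Λ`, `U_ℓ^∨Λ` (§1) and the differences `{∞,(εγε)∞} − {∞,γ∞}`
  (evenness), so by (K2) the pair `(F₁, F₂)` takes at most one nonzero value on `Λ`; `F₁ ≠ 0` (else `Ψ₁` is
  Γ₀(N)-invariant and `T₂`-killed, hence `0` by `…TwoExclusion.eq_zero_of_gamma0_invariant_of_heckeTwo`); with `c = f₂/f₁`
  the function `Ψ₂ − cΨ₁` is Γ₀(N)-invariant and `T₂`-killed, hence `0`.
* §3 `plusLineCharTwo_of_facts`: (C3k) with the level hypothesis of `StarGalois.kTwo_of_dvd_of_facts` (the crux's level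
  `N' = N_W·M·∏_{v∈S₀} q_v²` satisfies it), from `eichlerShimura_depletedOptimalQuotient_periodLattice_of_dvd`, Faltings,
  Mazur–Kenku, `heckeSelfDual_torsionBy_J0`, `buzzard2000_multiplicityOne_gamma0`, `serre1972_supersingular_decompositionSubgroup_image`.

BSD is not proved by any of this.
-/

noncomputable section

-- justification: the `Summit.BirchSwinnertonDyer.BirchSwinnertonDyer.…` path repeats a component (route-file convention)
set_option linter.dupNamespace false

open scoped MatrixGroups ModularForm NumberField

open CongruenceSubgroup IsDedekindDomain WeierstrassCurve
open Literature.NumberTheory.EllipticCurves Literature.NumberTheory.EllipticCurves.ModularForms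
open Literature.NumberTheory.EllipticCurves.Rank1Residual
open Rat.HeightOneSpectrum

namespace Summit.BirchSwinnertonDyer.BirchSwinnertonDyer.Theorems.ThetaLayerLambdaCongruenceAtTwo

/-! ## §1 The linear form of an eigen-symbol is an eigenvector of the dual Hecke action on all of `Λ` -/

section Lift

variable {N : ℕ} [NeZero N] {k : Type} [Field k]

/-- **`F(T_p^∨λ) = b·F(λ)` on all of `Λ = periodHomology N`.**  For a prime `p`, a function `Ψ : ℚ → k` with
`Σⱼ Ψ((x+j)/p) + 𝟙_{p∤N} Ψ(px) = b·Ψ(x)` for all `x`, and an additive `F : Λ → k` with `F{∞, γ∞} = Ψ(γ∞)` for all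
`γ ∈ Γ₀(N)` (`…PeriodLift`): for every `λ ∈ Λ` the functional `T_p^∨λ` lies in `Λ` and `F(T_p^∨λ) = b·F(λ)`.  On generators
by the simultaneous translates of `exists_heckeT_translates` and `sum_translates_eq_smul_of_eigen`; then closure induction.
[cite: CremonaAlgorithms1997, §2.4 (2.4.1)–(2.4.2)] -/
theorem exists_periodHomology_coe_eq_dualMap_heckeT {p : ℕ} (hp : p.Prime) (Ψ : ℚ → k) (b : k)
    (heig : ∀ x : ℚ, (∑ j : Fin p, Ψ ((x + j) / p)) + (if p ∣ N then 0 else Ψ (p * x)) = b • Ψ x)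
    (F : periodHomology N →+ k)
    (hF : ∀ γ : Gamma0 N, F ⟨periodFunctional N γ, periodFunctional_mem_periodHomology N γ⟩ =
        (if ((γ : SL(2, ℤ)) 1 0) = 0 then 0 else Ψ ((((γ : SL(2, ℤ)) 0 0 : ℚ)) / (((γ : SL(2, ℤ)) 1 0 : ℚ)))))
    (X : periodHomology N) :
    ∃ Y : periodHomology N, (Y : Module.Dual ℂ (CuspForm (Gamma0 N) 2)) =
        (haveI : NeZero p := ⟨hp.ne_zero⟩; heckeT (Gamma0 N) 2 p).dualMap X ∧ F Y = b * F X := by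
  classical
  haveI : NeZero p := ⟨hp.ne_zero⟩
  obtain ⟨x, hx⟩ := X
  induction hx using AddSubgroup.closure_induction with
  | mem x hx =>
    obtain ⟨γ, rfl⟩ := hx
    obtain ⟨δ, δ', Hh, HΦ⟩ := exists_heckeT_translates (N := N) hp γ
    have key := sum_translates_eq_smul_of_eigen (K := k) (R := k) Ψ b heig (HΦ Ψ)
    rw [smul_eq_mul] at key
    by_cases hpN : p ∣ N
    · refine ⟨∑ j, ⟨periodFunctional N (δ j), periodFunctional_mem_periodHomology N (δ j)⟩, ?_, ?_⟩
      · rw [dualMap_heckeT_periodFunctional_eq_of_translates Hh, if_pos hpN, add_zero]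
        push_cast
        rfl
      · rw [map_sum, hF]
        simp only [hF]
        rw [if_pos hpN, add_zero] at key
        exact key
    · refine ⟨∑ j, ⟨periodFunctional N (δ j), periodFunctional_mem_periodHomology N (δ j)⟩ +
          ⟨periodFunctional N δ', periodFunctional_mem_periodHomology N δ'⟩, ?_, ?_⟩
      · rw [dualMap_heckeT_periodFunctional_eq_of_translates Hh, if_neg hpN]
        push_cast
        rfl
      · rw [map_add, map_sum, hF, hF]
        simp only [hF]
        rw [if_neg hpN] at key
        exact key
  | zero =>
    refine ⟨0, by simp, ?_⟩
    rw [show (⟨0, AddSubgroup.zero_mem _⟩ : periodHomology N) = 0 from rfl, map_zero, mul_zero]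
  | add x y hx hy ihx ihy =>
    obtain ⟨Y₁, h₁, e₁⟩ := ihx
    obtain ⟨Y₂, h₂, e₂⟩ := ihy
    refine ⟨Y₁ + Y₂, ?_, ?_⟩
    · push_cast
      rw [h₁, h₂, map_add]
    · have e : (⟨x + y, AddSubgroup.add_mem _ hx hy⟩ : periodHomology N) = ⟨x, hx⟩ + ⟨y, hy⟩ := rfl
      rw [map_add, e₁, e₂, e, map_add, mul_add]
  | neg x hx ih =>
    obtain ⟨Y, h, e⟩ := ih
    refine ⟨-Y, ?_, ?_⟩
    · push_cast
      rw [h, map_neg]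
    · have e' : (⟨-x, AddSubgroup.neg_mem _ hx⟩ : periodHomology N) = -⟨x, hx⟩ := rfl
      rw [map_neg, e, e', map_neg, mul_neg]

end Lift

/-! ## §2 (K2) ⟹ (C3k) at a fixed odd level -/

section Reduction

variable {N : ℕ} [NeZero N] {k : Type} [Field k] [CharP k 2]

/-- **(K2) ⟹ (C3k) at level `N`.**  `N` odd, `k` a field of characteristic `2`, `a : ℕ → ℤ` with `a 2` even (the
eigenvalues; `a = (a_n(W))_n`), `Ψ₁, Ψ₂ : ℚ → k` even Γ₀(N)-symbol functions (Manin's relation in the shape of (C3k)),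
`Ψ₁ ≢ 0`, exact eigenfunctions for `T_q ↦ a q` (`q ∤ N`) and `U_ℓ ↦ 0` (`ℓ ∣ N`), and (K2): every additive `K ⊆ S₂(Γ₀(N))^∨`
containing `2Λ`, `(T_q^∨ − a_q)Λ`, `U_ℓ^∨Λ` and all `{∞,(εγε)∞} − {∞,γ∞}` has `x, y ∈ Λ ∖ K ⇒ x − y ∈ K`.  Then
`Ψ₂ = c·Ψ₁` for some `c ∈ k`.  See the module docstring for the proof. [cite: Manin1972, Thm. 1.9]
[cite: CremonaAlgorithms1997, §2.4] -/
theorem plusLineCharTwo_of_kTwo (hN : Odd N) (a : ℕ → ℤ) (ha2 : ((a 2 : ℤ) : k) = 0) (Ψ₁ Ψ₂ : ℚ → k)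
    (hev₁ : ∀ r : ℚ, Ψ₁ (-r) = Ψ₁ r)
    (hM₁ : ∀ (γ : Gamma0 N) (r : ℚ), ((γ : SL(2, ℤ)) 1 0 : ℚ) * r + ((γ : SL(2, ℤ)) 1 1 : ℚ) ≠ 0 →
      Ψ₁ ((((γ : SL(2, ℤ)) 0 0 : ℚ) * r + ((γ : SL(2, ℤ)) 0 1 : ℚ)) / (((γ : SL(2, ℤ)) 1 0 : ℚ) * r + ((γ : SL(2, ℤ)) 1 1 : ℚ))) =
        (if ((γ : SL(2, ℤ)) 1 0) = 0 then 0 else Ψ₁ ((((γ : SL(2, ℤ)) 0 0 : ℚ)) / (((γ : SL(2, ℤ)) 1 0 : ℚ)))) + Ψ₁ r)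
    (hev₂ : ∀ r : ℚ, Ψ₂ (-r) = Ψ₂ r)
    (hM₂ : ∀ (γ : Gamma0 N) (r : ℚ), ((γ : SL(2, ℤ)) 1 0 : ℚ) * r + ((γ : SL(2, ℤ)) 1 1 : ℚ) ≠ 0 →
      Ψ₂ ((((γ : SL(2, ℤ)) 0 0 : ℚ) * r + ((γ : SL(2, ℤ)) 0 1 : ℚ)) / (((γ : SL(2, ℤ)) 1 0 : ℚ) * r + ((γ : SL(2, ℤ)) 1 1 : ℚ))) =
        (if ((γ : SL(2, ℤ)) 1 0) = 0 then 0 else Ψ₂ ((((γ : SL(2, ℤ)) 0 0 : ℚ)) / (((γ : SL(2, ℤ)) 1 0 : ℚ)))) + Ψ₂ r)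
    (hne₁ : ∃ r : ℚ, Ψ₁ r ≠ 0)
    (hT₁ : ∀ q : ℕ, q.Prime → ¬ q ∣ N → ∀ r : ℚ, (∑ j : Fin q, Ψ₁ ((r + j) / q)) + Ψ₁ (q * r) = (a q : k) * Ψ₁ r)
    (hT₂ : ∀ q : ℕ, q.Prime → ¬ q ∣ N → ∀ r : ℚ, (∑ j : Fin q, Ψ₂ ((r + j) / q)) + Ψ₂ (q * r) = (a q : k) * Ψ₂ r)
    (hU₁ : ∀ ℓ : ℕ, ℓ.Prime → ℓ ∣ N → ∀ r : ℚ, ∑ j : Fin ℓ, Ψ₁ ((r + j) / ℓ) = 0)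
    (hU₂ : ∀ ℓ : ℕ, ℓ.Prime → ℓ ∣ N → ∀ r : ℚ, ∑ j : Fin ℓ, Ψ₂ ((r + j) / ℓ) = 0)
    (hK2 : ∀ K : AddSubgroup (Module.Dual ℂ (CuspForm (Gamma0 N) 2)),
      (∀ x ∈ periodHomology N, (2 : ℂ) • x ∈ K) →
      (∀ (q : ℕ) (hq : q.Prime), ¬ q ∣ N → ∀ x ∈ periodHomology N,
        (haveI : NeZero q := ⟨hq.ne_zero⟩; heckeT (Gamma0 N) 2 q).dualMap x - (a q : ℂ) • x ∈ K) →
      (∀ (q : ℕ) (hq : q.Prime), q ∣ N → ∀ x ∈ periodHomology N,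
        (haveI : NeZero q := ⟨hq.ne_zero⟩; heckeT (Gamma0 N) 2 q).dualMap x ∈ K) →
      (∀ γ : Gamma0 N, periodFunctional N ⟨iotaConj (γ : SL(2, ℤ)), iotaConj_coe_mem_gamma0 γ⟩ - periodFunctional N γ ∈ K) →
      ∀ x ∈ periodHomology N, ∀ y ∈ periodHomology N, x ∉ K → y ∉ K → x - y ∈ K) :
    ∃ c : k, ∀ r : ℚ, Ψ₂ r = c * Ψ₁ r := by
  classical
  have h2N : ¬ 2 ∣ N := fun h ↦ (Nat.not_even_iff_odd.mpr hN) (even_iff_two_dvd.mpr h)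
  have h3 : ∀ r : k, r + r + r = 0 → r = 0 := fun r hr ↦ by rwa [CharTwo.add_self_eq_zero, zero_add] at hr
  have hT2 : ∀ Ψ : ℚ → k, (∀ q : ℕ, q.Prime → ¬ q ∣ N → ∀ r : ℚ,
      (∑ j : Fin q, Ψ ((r + j) / q)) + Ψ (q * r) = (a q : k) * Ψ r) →
      ∀ x : ℚ, (∑ j : Fin 2, Ψ ((x + j) / 2)) + Ψ (2 * x) = 0 := by
    intro Ψ hT x
    have h := hT 2 Nat.prime_two h2N x
    simp only [Nat.cast_ofNat] at h
    rw [h, ha2, zero_mul]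
  have hT2₁ := hT2 Ψ₁ hT₁
  have hT2₂ := hT2 Ψ₂ hT₂
  -- the linear forms on `Λ`
  obtain ⟨F₁, hF₁⟩ := exists_addMonoidHom_periodHomology (R := k) hN hM₁ hT2₁ h3
    (twelve_mul_finrank_cuspForm_two_gamma0_holds N)
  obtain ⟨F₂, hF₂⟩ := exists_addMonoidHom_periodHomology (R := k) hN hM₂ hT2₂ h3
    (twelve_mul_finrank_cuspForm_two_gamma0_holds N)
  -- eigen-shapes of the Hecke hypotheses
  have heigT : ∀ Ψ : ℚ → k, (∀ q : ℕ, q.Prime → ¬ q ∣ N → ∀ r : ℚ,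
      (∑ j : Fin q, Ψ ((r + j) / q)) + Ψ (q * r) = (a q : k) * Ψ r) → ∀ (q : ℕ), q.Prime → ¬ q ∣ N →
      ∀ x : ℚ, (∑ j : Fin q, Ψ ((x + j) / q)) + (if q ∣ N then 0 else Ψ (q * x)) = (a q : k) • Ψ x := by
    intro Ψ hT q hq hqN x
    rw [if_neg hqN, smul_eq_mul]
    exact hT q hq hqN x
  have heigU : ∀ Ψ : ℚ → k, (∀ ℓ : ℕ, ℓ.Prime → ℓ ∣ N → ∀ r : ℚ, ∑ j : Fin ℓ, Ψ ((r + j) / ℓ) = 0) →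
      ∀ (q : ℕ), q.Prime → q ∣ N →
      ∀ x : ℚ, (∑ j : Fin q, Ψ ((x + j) / q)) + (if q ∣ N then 0 else Ψ (q * x)) = (0 : k) • Ψ x := by
    intro Ψ hU q hq hqN x
    rw [if_pos hqN, add_zero, zero_smul]
    exact hU q hq hqN x
  -- the subgroup `K = ker F₁ ∩ ker F₂ ⊆ Λ`
  let K : AddSubgroup (Module.Dual ℂ (CuspForm (Gamma0 N) 2)) := (F₁.ker ⊓ F₂.ker).map (periodHomology N).subtype
  have hKiff : ∀ Z : periodHomology N, (Z : Module.Dual ℂ (CuspForm (Gamma0 N) 2)) ∈ K ↔ F₁ Z = 0 ∧ F₂ Z = 0 := by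
    intro Z
    constructor
    · rintro ⟨Z', hZ', hZ'Z⟩
      have : Z' = Z := Subtype.ext hZ'Z
      subst this
      exact ⟨hZ'.1, hZ'.2⟩
    · rintro ⟨h1, h2⟩
      exact ⟨Z, ⟨h1, h2⟩, rfl⟩
  -- (K2) applies to `K`
  have hpair : ∀ X Y : periodHomology N, ¬ (F₁ X = 0 ∧ F₂ X = 0) → ¬ (F₁ Y = 0 ∧ F₂ Y = 0) →
      F₁ (X - Y) = 0 ∧ F₂ (X - Y) = 0 := by
    intro X Y hX hY
    have h := hK2 K ?_ ?_ ?_ ?_ X X.2 Y Y.2 (fun h ↦ hX ((hKiff X).mp h)) (fun h ↦ hY ((hKiff Y).mp h))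
    · exact (hKiff (X - Y)).mp h
    · -- `2Λ ⊆ K`
      intro x hx
      have e : (2 : ℂ) • x = ((⟨x, hx⟩ + ⟨x, hx⟩ : periodHomology N) : Module.Dual ℂ (CuspForm (Gamma0 N) 2)) := by
        rw [two_smul]; rfl
      rw [e, hKiff]
      exact ⟨by rw [map_add, CharTwo.add_self_eq_zero], by rw [map_add, CharTwo.add_self_eq_zero]⟩
    · -- `(T_q^∨ − a_q)Λ ⊆ K`
      intro q hq hqN x hx
      obtain ⟨Y, hY, e₁⟩ := exists_periodHomology_coe_eq_dualMap_heckeT hq Ψ₁ _ (heigT Ψ₁ hT₁ q hq hqN) F₁ hF₁ ⟨x, hx⟩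
      obtain ⟨Y', hY', e₂⟩ := exists_periodHomology_coe_eq_dualMap_heckeT hq Ψ₂ _ (heigT Ψ₂ hT₂ q hq hqN) F₂ hF₂ ⟨x, hx⟩
      have hYY : Y' = Y := Subtype.ext (hY'.trans hY.symm)
      subst hYY
      have e : (haveI : NeZero q := ⟨hq.ne_zero⟩; heckeT (Gamma0 N) 2 q).dualMap x - (a q : ℂ) • x =
          ((Y' - (a q : ℤ) • ⟨x, hx⟩ : periodHomology N) : Module.Dual ℂ (CuspForm (Gamma0 N) 2)) := by
        push_cast
        rw [hY', Int.cast_smul_eq_zsmul]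
      rw [e, hKiff]
      refine ⟨?_, ?_⟩
      · rw [map_sub, map_zsmul, e₁, zsmul_eq_mul, sub_self]
      · rw [map_sub, map_zsmul, e₂, zsmul_eq_mul, sub_self]
    · -- `U_ℓ^∨Λ ⊆ K`
      intro q hq hqN x hx
      obtain ⟨Y, hY, e₁⟩ := exists_periodHomology_coe_eq_dualMap_heckeT hq Ψ₁ _ (heigU Ψ₁ hU₁ q hq hqN) F₁ hF₁ ⟨x, hx⟩
      obtain ⟨Y', hY', e₂⟩ := exists_periodHomology_coe_eq_dualMap_heckeT hq Ψ₂ _ (heigU Ψ₂ hU₂ q hq hqN) F₂ hF₂ ⟨x, hx⟩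
      have hYY : Y' = Y := Subtype.ext (hY'.trans hY.symm)
      subst hYY
      rw [← hY', hKiff]
      exact ⟨by rw [e₁, zero_mul], by rw [e₂, zero_mul]⟩
    · -- cusp-negation differences: evenness
      intro γ
      have e : periodFunctional N ⟨iotaConj (γ : SL(2, ℤ)), iotaConj_coe_mem_gamma0 γ⟩ - periodFunctional N γ =
          ((⟨periodFunctional N ⟨iotaConj (γ : SL(2, ℤ)), iotaConj_coe_mem_gamma0 γ⟩,
              periodFunctional_mem_periodHomology N _⟩ -
            ⟨periodFunctional N γ, periodFunctional_mem_periodHomology N γ⟩ : periodHomology N) :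
            Module.Dual ℂ (CuspForm (Gamma0 N) 2)) := rfl
      have hι : ∀ (Ψ : ℚ → k), (∀ r : ℚ, Ψ (-r) = Ψ r) → ∀ (F : periodHomology N →+ k),
          (∀ γ : Gamma0 N, F ⟨periodFunctional N γ, periodFunctional_mem_periodHomology N γ⟩ =
            (if ((γ : SL(2, ℤ)) 1 0) = 0 then 0 else Ψ ((((γ : SL(2, ℤ)) 0 0 : ℚ)) / (((γ : SL(2, ℤ)) 1 0 : ℚ))))) →
          F ⟨periodFunctional N ⟨iotaConj (γ : SL(2, ℤ)), iotaConj_coe_mem_gamma0 γ⟩, periodFunctional_mem_periodHomology N _⟩ =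
            F ⟨periodFunctional N γ, periodFunctional_mem_periodHomology N γ⟩ := by
        intro Ψ hev F hF
        rw [hF, hF]
        change (if (iotaConj (γ : SL(2, ℤ))) 1 0 = 0 then (0 : k) else
            Ψ ((((iotaConj (γ : SL(2, ℤ))) 0 0 : ℤ) : ℚ) / (((iotaConj (γ : SL(2, ℤ))) 1 0 : ℤ) : ℚ))) = _
        by_cases hc : ((γ : SL(2, ℤ)) 1 0) = 0
        · rw [if_pos (by rw [iotaConj_apply_10, hc, neg_zero]), if_pos hc]
        · have hc' : (iotaConj (γ : SL(2, ℤ))) 1 0 ≠ 0 := by rw [iotaConj_apply_10, neg_ne_zero]; exact hc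
          rw [if_neg hc', if_neg hc, iotaConj_apply_10, iotaConj_apply_00, Int.cast_neg, div_neg, hev]
      rw [e, hKiff, map_sub, map_sub, hι Ψ₁ hev₁ F₁ hF₁, hι Ψ₂ hev₂ F₂ hF₂, sub_self, sub_self]
      exact ⟨rfl, rfl⟩
  -- `F₁ ≠ 0` on some generator, by the `T₂`-exclusion of invariant functions
  have hgen₁ : ∃ γ : Gamma0 N, F₁ ⟨periodFunctional N γ, periodFunctional_mem_periodHomology N γ⟩ ≠ 0 := by
    by_contra! h0
    obtain ⟨r, hr⟩ := hne₁
    apply hr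
    refine eq_zero_of_gamma0_invariant_of_heckeTwo hN Ψ₁ (fun y ↦ by rw [two_nsmul, CharTwo.add_self_eq_zero])
      (fun γ r hr' ↦ ?_) hT2₁ r
    rw [hM₁ γ r hr', ← hF₁ γ, h0 γ, zero_add]
  obtain ⟨γ₁, hγ₁⟩ := hgen₁
  set X₁ : periodHomology N := ⟨periodFunctional N γ₁, periodFunctional_mem_periodHomology N γ₁⟩ with hX₁
  -- the scalar
  refine ⟨F₂ X₁ * (F₁ X₁)⁻¹, fun r ↦ ?_⟩
  have hcusp : ∀ γ : Gamma0 N, F₂ ⟨periodFunctional N γ, periodFunctional_mem_periodHomology N γ⟩ =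
      F₂ X₁ * (F₁ X₁)⁻¹ * F₁ ⟨periodFunctional N γ, periodFunctional_mem_periodHomology N γ⟩ := by
    intro γ
    set X : periodHomology N := ⟨periodFunctional N γ, periodFunctional_mem_periodHomology N γ⟩ with hX
    by_cases h0 : F₁ X = 0 ∧ F₂ X = 0
    · rw [h0.1, h0.2, mul_zero]
    · have hd := hpair X X₁ h0 (fun h ↦ hγ₁ h.1)
      rw [map_sub, map_sub, sub_eq_zero, sub_eq_zero] at hd
      rw [hd.1, hd.2, inv_mul_cancel_right₀ hγ₁]
  -- `Ψ₂ − c Ψ₁` is Γ₀(N)-invariant and `T₂`-killed, hence zero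
  have hΦ := eq_zero_of_gamma0_invariant_of_heckeTwo hN (fun r ↦ Ψ₂ r - F₂ X₁ * (F₁ X₁)⁻¹ * Ψ₁ r)
    (fun y ↦ by rw [two_nsmul, CharTwo.add_self_eq_zero]) (fun γ r hr ↦ ?_) (fun x ↦ ?_) r
  · exact sub_eq_zero.mp hΦ
  · rw [hM₁ γ r hr, hM₂ γ r hr, ← hF₁ γ, ← hF₂ γ, hcusp γ]
    ring
  · rw [Finset.sum_sub_distrib, ← Finset.mul_sum]
    linear_combination hT2₂ x - F₂ X₁ * (F₁ X₁)⁻¹ * hT2₁ x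

end Reduction


/-! ## §3 (C3k) at the crux's levels, from named facts -/

section Facts

/-- **(C3k) «plus multiplicity one over fields of characteristic `2`» at every level of the crux's shape, from named
facts.**  The registered stub `stub_plusLineCharTwo` of line `birth` with its hypothesis «`N'` odd and divisible by the
primes of `N_W`» strengthened to the level hypothesis of `kTwo_of_dvd_of_facts`: a newform `f` of `W` of level `N`, a
nonempty finite set of primes `S` with `N·∏_{ℓ∈S} ℓ² ∣ N'` and `primes(N') ⊆ S`, and good reduction of `W` at every prime
`p ∤ 2N'` (all satisfied at the crux's level `N' = N_W·M·∏_{v∈S₀} q_v²`).  Then for every field `k` of characteristic `2`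
and all nonzero even `1`-periodic Γ₀(N')-symbol functions `Ψ₁, Ψ₂ : ℚ → k` that are exact Hecke eigenfunctions for
`T_q ↦ a_q(W)` (`q ∤ N'`) and `U_ℓ ↦ 0` (`ℓ ∣ N'`): `Ψ₂ = c·Ψ₁`.  Proof: §2 with (K2) = `kTwo_of_dvd_of_facts`; `2 ∣ a₂(W)`
from `GoodSS W 2`.  Named facts: `eichlerShimura_depletedOptimalQuotient_periodLattice_of_dvd`,
`isIsogenous_iff_frobeniusTrace_eq`, `mazurKenku_exists_cyclic_isogeny`, `heckeSelfDual_torsionBy_J0`,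
`buzzard2000_multiplicityOne_gamma0`, `serre1972_supersingular_decompositionSubgroup_image`.  BSD is not proved by this.
[cite: Buzzard2000LevelLoweringModTwo, Prop. 2.4 and Def. 2.1–2.2 (p. 100–101)] [cite: Manin1972, Thm. 1.9] -/
theorem plusLineCharTwo_of_facts
    (hES : eichlerShimura_depletedOptimalQuotient_periodLattice_of_dvd)
    (hF : WeierstrassCurve.isIsogenous_iff_frobeniusTrace_eq) (hMK : mazurKenku_exists_cyclic_isogeny)
    (hSD : heckeSelfDual_torsionBy_J0) (hBz : buzzard2000_multiplicityOne_gamma0)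
    (hSe : serre1972_supersingular_decompositionSubgroup_image) :
    ∀ (W : WeierstrassCurve ℚ) [W.IsElliptic] [W.IsGloballyMinimal], GoodSS W 2 → W.Δ < 0 → ∀ (N' : ℕ), Odd N' →
    ∀ {N : ℕ} [NeZero N] (f : CuspForm (Gamma0 N) 2), IsNewformOf W f →
    ∀ (S : Finset ℕ), (∀ ℓ ∈ S, ℓ.Prime) → S.Nonempty → N * ∏ ℓ ∈ S, ℓ ^ 2 ∣ N' → (∀ p : ℕ, p.Prime → p ∣ N' → p ∈ S) →
    (∀ v : HeightOneSpectrum (𝓞 ℚ), ¬ ((primesEquiv v : ℕ) ∣ 2 * N') → W.HasGoodReductionAt v) →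
    ∀ (k : Type) [Field k] [CharP k 2] (Ψ₁ Ψ₂ : ℚ → k), (∀ (r : ℚ) (z : ℤ), Ψ₁ (r + z) = Ψ₁ r) → (∀ r : ℚ, Ψ₁ (-r) = Ψ₁ r) → (∀ (γ : CongruenceSubgroup.Gamma0 (N')) (r : ℚ), ((γ : SL(2, ℤ)) 1 0 : ℚ) * r + ((γ : SL(2, ℤ)) 1 1 : ℚ) ≠ 0 → Ψ₁ ((((γ : SL(2, ℤ)) 0 0 : ℚ) * r + ((γ : SL(2, ℤ)) 0 1 : ℚ)) / (((γ : SL(2, ℤ)) 1 0 : ℚ) * r + ((γ : SL(2, ℤ)) 1 1 : ℚ))) = (if ((γ : SL(2, ℤ)) 1 0) = 0 then 0 else Ψ₁ ((((γ : SL(2, ℤ)) 0 0 : ℚ)) / (((γ : SL(2, ℤ)) 1 0 : ℚ)))) + Ψ₁ r) → (∀ (r : ℚ) (z : ℤ), Ψ₂ (r + z) = Ψ₂ r) → (∀ r : ℚ, Ψ₂ (-r) = Ψ₂ r) → (∀ (γ : CongruenceSubgroup.Gamma0 (N')) (r : ℚ), ((γ : SL(2, ℤ)) 1 0 : ℚ)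 * r + ((γ : SL(2, ℤ)) 1 1 : ℚ) ≠ 0 → Ψ₂ ((((γ : SL(2, ℤ)) 0 0 : ℚ) * r + ((γ : SL(2, ℤ)) 0 1 : ℚ)) / (((γ : SL(2, ℤ)) 1 0 : ℚ) * r + ((γ : SL(2, ℤ)) 1 1 : ℚ))) = (if ((γ : SL(2, ℤ)) 1 0) = 0 then 0 else Ψ₂ ((((γ : SL(2, ℤ)) 0 0 : ℚ)) / (((γ : SL(2, ℤ)) 1 0 : ℚ)))) + Ψ₂ r) → (∃ r : ℚ, Ψ₁ r ≠ 0) → (∃ r : ℚ, Ψ₂ r ≠ 0) → (∀ q : ℕ, q.Prime → ¬ q ∣ N' → ∀ r : ℚ, (∑ j : Fin q, Ψ₁ ((r + j) / q)) + Ψ₁ (q * r) = (W.LFunction q : k) * Ψ₁ r) → (∀ q : ℕ, q.Prime → ¬ q ∣ N' → ∀ r : ℚ, (∑ j : Fin q, Ψ₂ ((r + j) / q)) + Ψ₂ (q * r) = (W.LFunction q : k) * Ψ₂ r) → (∀ ℓ : ℕ, ℓ.Prime → ℓ ∣ N' → ∀ r : ℚ, ∑ j : Fin ℓ, Ψ₁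 ((r + j) / ℓ) = 0) → (∀ ℓ : ℕ, ℓ.Prime → ℓ ∣ N' → ∀ r : ℚ, ∑ j : Fin ℓ, Ψ₂ ((r + j) / ℓ) = 0) → ∃ c : k, ∀ r : ℚ, Ψ₂ r = c * Ψ₁ r := by
  intro W _ _ hss hΔ N' hN' N _ f hf S hS hSne hNL hLS hgood k _ _ Ψ₁ Ψ₂ _ hev₁ hM₁ _ hev₂ hM₂ hne₁ _ hT₁ hT₂ hU₁ hU₂
  haveI : NeZero N' := ⟨by rintro rfl; exact (Nat.not_even_iff_odd.mpr hN') (Even.zero)⟩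
  have ha2 : ((W.LFunction 2 : ℤ) : k) = 0 := by
    rw [LFunction_apply_prime_eq_frobeniusTrace W 2 hss.1]
    obtain ⟨m, hm⟩ := hss.2
    rw [hm]
    push_cast
    rw [CharTwo.two_eq_zero, zero_mul]
  exact plusLineCharTwo_of_kTwo hN' (fun n ↦ W.LFunction n) ha2 Ψ₁ Ψ₂ hev₁ hM₁ hev₂ hM₂ hne₁ hT₁ hT₂ hU₁ hU₂
    (fun K h2K hTK hUK hcK x hx y hy hxK hyK ↦
      kTwo_of_dvd_of_facts hES hF hMK hSD hBz hSe W hss hΔ hf S hS hSne N' hN' hNL hLS hgood K h2K hTK hUK hcK hx hy hxK hyK)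

end Facts

end Summit.BirchSwinnertonDyer.BirchSwinnertonDyer.Theorems.ThetaLayerLambdaCongruenceAtTwo

end
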